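import Summits.CriticalPhenomena.SAWScalingLimit.Theses.SAWDevelopingMap
import Summits.CriticalPhenomena.SAWScalingLimit.Theorems.BoundaryClosureNegative_Instance

/-!
# Negative lemma for the crux `SAWDevelopingMap.ObservableToSLE` (stmt-CriticalPhenomena-10472),
line `floor-ratio-restriction-bootstrap`: the exact-row clause AT THE ROOT is load-bearing in the
floor-ratio limit (stub 1, `TargetTransport := HexObservableLimit → FloorRatioLimit`)

Refuter `drefute` (stub attack on the picked line, opening, 2026-08-16).  Two `Prop`s are refuted:

* `FloorRatioLimitUnpinned` — a VERBATIM copy of `FloorRatioLimit` as the crux-plan skeleton typed it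
  (`Cruxes/ObservableToSLE/Lines/floor-ratio-restriction-bootstrap.lean`, commit eead1a5a399f, typed
  against the pre-rev-4 hypothesis: the root `a δ` is tied to `D.pt 0` only through `a δ ∈ ∂Λ_δ` and
  the Euclidean limit).  With it, the then-registered `stub_targetTransport` was `¬ HexObservableLimit`
  in disguise and `stub_restrictionCocycle : FloorRatioLimit → …` was vacuous.
* `FloorRatioLimitRootFlat` — the lead's RESHAPED `FloorRatioLimit` (same file since 2026-08-16T00:38Z:
  root pinned as in the rev-4 `HexObservableLimit`) with ONLY the exact-row clause
  `∀ v, δ·c_v ∈ ball (D.pt 0) ρ → (v ∈ Λ δ ↔ m₀ δ ≤ v.1 1)` (and its binder `m₀`) deleted, the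
  flatness of `D` at `pt 0` being KEPT.  Its falsity says: of the two root clauses added by the
  reshape, the half-lattice-rows clause is the load-bearing one — any proof of the reshaped stub 1
  must use it (flatness of the Jordan domain at the root does not control the discretisation there).

Crux work files cannot be imported under `Theorems/`, hence the copies.  The reshaped, fully pinned
`FloorRatioLimit` is NOT touched by the witness (it is two instances of `HexObservableLimit` divided).

## The witness (reusing the landed corridor modules `BoundaryClosureNegative_*`)

Domain: the upper half unit disc `HD`, normalisation points `b = 0` (`D.pt 1`) and `b' = 1/4`
(`D'.pt 1`, the re-marked domain `halfDiscDomainQ`), root `D.pt 0 = r` with `r = 1/2`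
(configuration `wc = false`: the body `Lam δ false`, root at the junction edge `aEdge X`, a moat to
its right) or `r = 3/4` (`wc = true`: body ∪ row-`0` corridor, root at the tip edge `aEdge T`); all of
`0, 1/4, r` are flat points of `HD` at radius `1/4`, and the discretisation is the exact half-lattice
in the balls about `0` and `1/4` (both inside `ball 0 (1/2)`, `mem_Lam_iff_of_ball`) but NOT about `r`.
Every other hypothesis holds for both configurations (new items: the second normalisation edge
`bEdgeQ (Nc δ)` below the row-`0` face of cell `Nc δ = ⌊1/(4δ)⌋`, its boundary membership, its limit
`1/4`, a straight self-avoiding walk to it, the boundary value of `L_r` at `1/4`).  By the corridor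
factorisation `observable_corridor` (`F^{body∪corridor}(a_T, z) = κ F^{body}(a_X, z)`, `κ ≠ 0`, at
every mid-edge `z` avoiding the corridor faces) the ratio `F_δ(b'_δ)/F_δ(b_δ)` is THE SAME number for
the two configurations once `δ ≤ 1/16` (`ratio_eq_corridor`), so the two predicted limits
`exp((5/8)(L_r(1/4) - L_r(0)))`, `r = 1/2, 3/4`, coincide; both exponents are real, hence equal, and
exponentiating gives `(p - x)(1 - p x)/p = (q - x)(1 - q x)/q` at `x = 1/4`, i.e.
`x (p - q)(1 - p q) = 0`: contradiction (numerically `(240/49)^{5/8} ≠ (540/169)^{5/8}`).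

Everything is proved; no named facts are used. [folklore]
-/

noncomputable section

open Set Filter Topology Complex MeasureTheory Metric
open scoped BigOperators NNReal ENNReal Classical
open Literature.Probability.RandomPlanarGeometry
open UpperHalfPlane (upperHalfPlaneSet)
open Literature.Probability.LatticeModels Literature.Probability.RandomPlanarGeometry.SAW

namespace Summit.CriticalPhenomena.SAWScalingLimit.Theorems.ObservableToSLE.Negative

open Summit.CriticalPhenomena.SAWScalingLimit.Theorems.BoundaryClosure.Negative

/-! ## The refuted statements -/

/-- `FloorRatioLimit` of the RESHAPED skeleton (lead, 2026-08-16T00:38Z) with the exact-row clause at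
the root `∀ v, δ·c_v ∈ ball (D.pt 0) ρ → (v ∈ Λ δ ↔ m₀ δ ≤ v.1 1)` and its binder `m₀` DELETED
(flatness of `D` at `pt 0` kept; everything else verbatim): two normalisation mid-edges
`b δ → D.pt 1`, `b' δ → D'.pt 1` on flat pieces with exact rows, `D'` a re-marking of the same Jordan
domain with the same source, one map `Φ : D → ℍ` (`a ↦ ∞`, `b ↦ 0`), one continuous logarithm `L`
of `Φ'` with limits `Lb`, `Lb'`; conclusion `F_δ(b'_δ)/F_δ(b_δ) → exp((5/8)(Lb' − Lb))`. -/
def FloorRatioLimitRootFlat : Prop :=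
  ∀ (D D' : DobrushinDomain) (ρ : ℝ) (Λ : ℝ → Finset HexVertex) (m m' : ℝ → ℤ)
    (a b b' : ℝ → Sym2 HexVertex) (Φ : ConformalEquiv D.carrier upperHalfPlaneSet)
    (L : ℂ → ℂ) (Lb Lb' : ℂ),
    let F : ℝ → Sym2 HexVertex → ℂ := fun δ z =>
      hexParafermionicObservable (Λ δ) (a δ) hexCriticalFugacity (5 / 8) z
    D'.carrier = D.carrier → D'.pt 0 = D.pt 0 → 0 < ρ →
    D.carrier ∩ ball (D.pt 0) ρ = {z : ℂ | (D.pt 0).im < z.im} ∩ ball (D.pt 0) ρ →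
    D.carrier ∩ ball (D.pt 1) ρ = {z : ℂ | (D.pt 1).im < z.im} ∩ ball (D.pt 1) ρ →
    D.carrier ∩ ball (D'.pt 1) ρ = {z : ℂ | (D'.pt 1).im < z.im} ∩ ball (D'.pt 1) ρ →
    (∀ᶠ δ : ℝ in 𝓝[>] 0,
      hexDomainSimplyConnected (Λ δ) ∧ a δ ∈ hexDomainBoundary (Λ δ) ∧
      b δ ∈ hexDomainBoundary (Λ δ) ∧ b' δ ∈ hexDomainBoundary (Λ δ) ∧
      Nonempty (HexMidEdgeSAW (Λ δ) (a δ) (b δ)) ∧ Nonempty (HexMidEdgeSAW (Λ δ) (a δ) (b' δ)) ∧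
      (hexGraph.induce (↑(Λ δ) : Set HexVertex)).Preconnected ∧
      (∀ v ∈ Λ δ, (δ : ℂ) * hexCenter v ∈ D.carrier) ∧
      (∀ v : HexVertex, (δ : ℂ) * hexCenter v ∈ ball (D.pt 1) ρ → (v ∈ Λ δ ↔ m δ ≤ v.1 1)) ∧
      (∀ v : HexVertex, (δ : ℂ) * hexCenter v ∈ ball (D'.pt 1) ρ → (v ∈ Λ δ ↔ m' δ ≤ v.1 1))) →
    (∀ K : Set ℂ, IsCompact K → K ⊆ D.carrier →
      ∀ᶠ δ : ℝ in 𝓝[>] 0, ∀ v : HexVertex, (δ : ℂ) * hexCenter v ∈ K → v ∈ Λ δ) →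
    Tendsto (fun δ : ℝ => (δ : ℂ) * hexMidpoint (a δ)) (𝓝[>] 0) (𝓝 (D.pt 0)) →
    Tendsto (fun δ : ℝ => (δ : ℂ) * hexMidpoint (b δ)) (𝓝[>] 0) (𝓝 (D.pt 1)) →
    Tendsto (fun δ : ℝ => (δ : ℂ) * hexMidpoint (b' δ)) (𝓝[>] 0) (𝓝 (D'.pt 1)) →
    Tendsto (fun x => ‖Φ x‖) (𝓝[D.carrier] (D.pt 0)) atTop →
    Φ.HasBoundaryValue (D.pt 1) 0 →
    ContinuousOn L D.carrier → (∀ z ∈ D.carrier, Complex.exp (L z) = deriv Φ z) →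
    Tendsto L (𝓝[D.carrier] (D.pt 1)) (𝓝 Lb) → Tendsto L (𝓝[D.carrier] (D'.pt 1)) (𝓝 Lb') →
    Tendsto (fun δ : ℝ => F δ (b' δ) / F δ (b δ)) (𝓝[>] 0)
      (𝓝 (Complex.exp ((5 / 8 : ℂ) * (Lb' - Lb))))

/-- VERBATIM copy of `FloorRatioRestrictionBootstrap.FloorRatioLimit` as the crux-plan skeleton typed
it (`Cruxes/ObservableToSLE/Lines/floor-ratio-restriction-bootstrap.lean`, commit eead1a5a399f; no
clause at all at `pt 0`): **S1 — the floor-ratio limit (target transport).**  Same quantifier shape as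
the pre-rev-4 `HexObservableLimit`, with TWO normalisation mid-edges `b δ → D.pt 1` and `b' δ → D'.pt 1`
on two flat horizontal pieces (domain above; row thresholds `m δ`, `m' δ`), `D'` a re-marking of the
same Jordan domain with the same source (`D'.carrier = D.carrier`, `D'.pt 0 = D.pt 0`), one map
`Φ : D → ℍ` (`a ↦ ∞`, `b ↦ 0`) and one continuous logarithm `L` of `Φ'` with limits `Lb`, `Lb'` at
the two points.  Conclusion: `F_δ(b'_δ)/F_δ(b_δ) → exp((5/8)(Lb' − Lb))`. -/
def FloorRatioLimitUnpinned : Prop :=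
  ∀ (D D' : DobrushinDomain) (ρ : ℝ) (Λ : ℝ → Finset HexVertex) (m m' : ℝ → ℤ)
    (a b b' : ℝ → Sym2 HexVertex) (Φ : ConformalEquiv D.carrier upperHalfPlaneSet)
    (L : ℂ → ℂ) (Lb Lb' : ℂ),
    let F : ℝ → Sym2 HexVertex → ℂ := fun δ z =>
      hexParafermionicObservable (Λ δ) (a δ) hexCriticalFugacity (5 / 8) z
    D'.carrier = D.carrier → D'.pt 0 = D.pt 0 → 0 < ρ →
    D.carrier ∩ ball (D.pt 1) ρ = {z : ℂ | (D.pt 1).im < z.im} ∩ ball (D.pt 1) ρ →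
    D.carrier ∩ ball (D'.pt 1) ρ = {z : ℂ | (D'.pt 1).im < z.im} ∩ ball (D'.pt 1) ρ →
    (∀ᶠ δ : ℝ in 𝓝[>] 0,
      hexDomainSimplyConnected (Λ δ) ∧ a δ ∈ hexDomainBoundary (Λ δ) ∧
      b δ ∈ hexDomainBoundary (Λ δ) ∧ b' δ ∈ hexDomainBoundary (Λ δ) ∧
      Nonempty (HexMidEdgeSAW (Λ δ) (a δ) (b δ)) ∧ Nonempty (HexMidEdgeSAW (Λ δ) (a δ) (b' δ)) ∧
      (hexGraph.induce (↑(Λ δ) : Set HexVertex)).Preconnected ∧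
      (∀ v ∈ Λ δ, (δ : ℂ) * hexCenter v ∈ D.carrier) ∧
      (∀ v : HexVertex, (δ : ℂ) * hexCenter v ∈ ball (D.pt 1) ρ → (v ∈ Λ δ ↔ m δ ≤ v.1 1)) ∧
      (∀ v : HexVertex, (δ : ℂ) * hexCenter v ∈ ball (D'.pt 1) ρ → (v ∈ Λ δ ↔ m' δ ≤ v.1 1))) →
    (∀ K : Set ℂ, IsCompact K → K ⊆ D.carrier →
      ∀ᶠ δ : ℝ in 𝓝[>] 0, ∀ v : HexVertex, (δ : ℂ) * hexCenter v ∈ K → v ∈ Λ δ) →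
    Tendsto (fun δ : ℝ => (δ : ℂ) * hexMidpoint (a δ)) (𝓝[>] 0) (𝓝 (D.pt 0)) →
    Tendsto (fun δ : ℝ => (δ : ℂ) * hexMidpoint (b δ)) (𝓝[>] 0) (𝓝 (D.pt 1)) →
    Tendsto (fun δ : ℝ => (δ : ℂ) * hexMidpoint (b' δ)) (𝓝[>] 0) (𝓝 (D'.pt 1)) →
    Tendsto (fun x => ‖Φ x‖) (𝓝[D.carrier] (D.pt 0)) atTop →
    Φ.HasBoundaryValue (D.pt 1) 0 →
    ContinuousOn L D.carrier → (∀ z ∈ D.carrier, Complex.exp (L z) = deriv Φ z) →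
    Tendsto L (𝓝[D.carrier] (D.pt 1)) (𝓝 Lb) → Tendsto L (𝓝[D.carrier] (D'.pt 1)) (𝓝 Lb') →
    Tendsto (fun δ : ℝ => F δ (b' δ) / F δ (b δ)) (𝓝[>] 0)
      (𝓝 (Complex.exp ((5 / 8 : ℂ) * (Lb' - Lb))))

/-- Dropping the root-flatness hypothesis: the crux-plan version implies the root-flat version. -/
theorem floorRatioLimitRootFlat_of_unpinned (H : FloorRatioLimitUnpinned) : FloorRatioLimitRootFlat :=
  fun D D' ρ Λ m m' a b b' Φ L Lb Lb' h1 h2 h3 _ h5 h6 h7 h8 h9 h10 h11 h12 h13 h14 h15 h16 h17 =>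
    H D D' ρ Λ m m' a b b' Φ L Lb Lb' h1 h2 h3 h5 h6 h7 h8 h9 h10 h11 h12 h13 h14 h15 h16 h17

/-! ## §1 The second normalisation edge `b'` at cell `N` and the cell `Nc δ = ⌊1/(4δ)⌋` -/

/-- The vertical boundary mid-edge below the row-`0` face of cell `N` (midpoint `N + 1/2`);
`bEdgeQ 0 = bEdge`. [folklore] -/
def bEdgeQ (N : ℤ) : Sym2 HexVertex := s(fj (2 * N) 0, fj (2 * N + 1) (-1))

/-- The cell of the second normalisation point `1/4`. [folklore] -/
def Nc (δ : ℝ) : ℤ := ⌊1 / (4 * δ)⌋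

/-- The midpoint of `bEdgeQ N` is the real number `N + 1/2`. [folklore] -/
theorem hexMidpoint_bEdgeQ (N : ℤ) : hexMidpoint (bEdgeQ N) = (((N : ℝ) + 1 / 2 : ℝ) : ℂ) := by
  unfold bEdgeQ
  rw [hexMidpoint_mk]
  apply Complex.ext
  · simp only [Complex.add_re, Complex.div_ofNat_re, re_hexCenter_fj, Complex.ofReal_re]
    push_cast; ring
  · simp only [Complex.add_im, Complex.div_ofNat_im, im_hexCenter_fj, Complex.ofReal_im]
    rw [show (2 * N) % 2 = 0 by omega, show (2 * N + 1) % 2 = 1 by omega]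
    push_cast; ring

/-- Bounds on the cell `Nc δ`: `1/(4δ) - 1 < Nc δ ≤ 1/(4δ)`. [folklore] -/
theorem Nc_bounds (δ : ℝ) : (Nc δ : ℝ) ≤ 1 / (4 * δ) ∧ 1 / (4 * δ) - 1 < (Nc δ : ℝ) :=
  ⟨Int.floor_le _, Int.sub_one_lt_floor _⟩

/-- `|δ · Nc δ - 1/4| ≤ δ`. [folklore] -/
theorem abs_Nc (δ : ℝ) (hδ : 0 < δ) : |δ * Nc δ - 1 / 4| ≤ δ := by
  have h := Nc_bounds δ
  have e : 1 / (4 * δ) = δ⁻¹ / 4 := by rw [one_div, mul_inv, inv_eq_one_div (4:ℝ)]; ring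
  rw [e] at h
  have e' : δ * δ⁻¹ = 1 := mul_inv_cancel₀ hδ.ne'
  rw [abs_le]; constructor <;> nlinarith [h.1, h.2]

/-- For `0 < δ ≤ 1/16`: `1 ≤ Nc δ < Xc δ`. [folklore] -/
theorem Nc_pos_lt_Xc {δ : ℝ} (hδ : 0 < δ) (hδ' : δ ≤ 1 / 16) : 1 ≤ Nc δ ∧ Nc δ < Xc δ := by
  have h := Nc_bounds δ
  have hX := (Xc_bounds δ).1
  have e : 1 / (4 * δ) = δ⁻¹ / 4 := by rw [one_div, mul_inv, inv_eq_one_div (4:ℝ)]; ring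
  rw [e] at h
  rw [one_div_two_mul] at hX
  have h16 := sixteen_le_inv hδ hδ'
  constructor
  · have : (0 : ℝ) < Nc δ := by linarith [h.2]
    exact_mod_cast (show (0 : ℤ) < Nc δ by exact_mod_cast this)
  · have : (Nc δ : ℝ) < Xc δ := by
      have : (0:ℝ) < δ⁻¹ := by positivity
      linarith [h.1]
    exact_mod_cast this

/-- **The rescaled second normalisation mid-edge converges to `1/4`.** [folklore] -/
theorem tendsto_smul_midpoint_bEdgeQ :
    Tendsto (fun δ : ℝ => (δ : ℂ) * hexMidpoint (bEdgeQ (Nc δ))) (𝓝[>] 0)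
      (𝓝 (((1 / 4 : ℝ)) : ℂ)) := by
  have e : (fun δ : ℝ => (δ : ℂ) * hexMidpoint (bEdgeQ (Nc δ))) =
      fun δ : ℝ => ((δ * ((Nc δ : ℝ) + 1 / 2) : ℝ) : ℂ) := by
    funext δ; rw [hexMidpoint_bEdgeQ]; push_cast; ring
  rw [e]
  refine (Complex.continuous_ofReal.tendsto _).comp ?_
  have h0 : Tendsto (fun δ : ℝ => δ) (𝓝[>] 0) (𝓝 0) :=
    tendsto_nhdsWithin_of_tendsto_nhds tendsto_id
  rw [Metric.tendsto_nhds]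
  intro ε hε
  have hev : ∀ᶠ δ : ℝ in 𝓝[>] 0, 0 < δ ∧ δ < ε / 4 := by
    have h1 : ∀ᶠ δ : ℝ in 𝓝[>] 0, 0 < δ := eventually_nhdsWithin_of_forall fun x hx => hx
    have h2 : ∀ᶠ δ : ℝ in 𝓝[>] 0, δ < ε / 4 := by
      have := (Metric.tendsto_nhds.1 h0) (ε / 4) (by positivity)
      refine this.mono fun x hx => ?_
      rw [Real.dist_eq, sub_zero] at hx
      exact (le_abs_self _).trans_lt hx
    exact h1.and h2
  refine hev.mono fun δ ⟨hδ0, hδε⟩ => ?_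
  have := abs_Nc δ hδ0
  rw [Real.dist_eq]
  calc |δ * ((Nc δ : ℝ) + 1 / 2) - 1 / 4| = |(δ * Nc δ - 1 / 4) + δ * (1 / 2)| := by ring_nf
    _ ≤ |δ * Nc δ - 1 / 4| + |δ * (1 / 2)| := abs_add_le _ _
    _ ≤ δ + δ * (1 / 2) := by rw [abs_of_pos (by positivity : (0:ℝ) < δ * (1 / 2))]; linarith
    _ < ε := by linarith

section Geometry

variable {δ : ℝ} (hδ : 0 < δ) (hδ' : δ ≤ 1 / 16) (wc : Bool)
include hδ hδ'

/-- The face below the row-`0` face of cell `N` is not a vertex. [folklore] -/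
theorem fj_neg_one_not_mem (j : ℤ) : fj j (-1) ∉ Lam δ wc := by
  rw [fj_mem_Lam_iff hδ hδ']
  rintro (hb | ⟨-, hc, -⟩)
  · have := hb.1.1.1; omega
  · omega

/-- **The second normalisation edge is a boundary mid-edge.** [folklore] -/
theorem bEdgeQ_mem_boundary : bEdgeQ (Nc δ) ∈ hexDomainBoundary (Lam δ wc) := by
  have hb := rootCell_bounds hδ hδ' wc
  have hN := Nc_pos_lt_Xc hδ hδ'
  refine ⟨(SimpleGraph.mem_edgeSet hexGraph).2 ?_, fj (2 * Nc δ + 1) (-1), fj (2 * Nc δ) 0,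
    Sym2.eq_swap, fj_row_zero_mem hδ hδ' wc (by omega) (by omega), fj_neg_one_not_mem hδ hδ' wc _⟩
  have := adj_fj_down (show (2 * Nc δ) % 2 = 0 by omega) 0
  rwa [show (0:ℤ) - 1 = -1 by norm_num] at this

end Geometry

/-! ### The straight walk along row `0` from the root edge down to `bEdgeQ k` -/

/-- The straight walk `[fj (k+m) 0, …, fj k 0]` along row `0`. [folklore] -/
def rowWalkFrom (k : ℤ) : ℕ → List HexVertex
  | 0 => [fj k 0]
  | m + 1 => fj (k + (m + 1 : ℕ)) 0 :: rowWalkFrom k m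

/-- Members of the straight walk. [folklore] -/
theorem mem_rowWalkFrom {k : ℤ} {m : ℕ} {v : HexVertex} :
    v ∈ rowWalkFrom k m ↔ ∃ i : ℕ, i ≤ m ∧ v = fj (k + i) 0 := by
  induction m with
  | zero =>
    simp only [rowWalkFrom, List.mem_singleton, Nat.le_zero]
    constructor
    · rintro rfl; exact ⟨0, rfl, by simp⟩
    · rintro ⟨i, rfl, rfl⟩; simp
  | succ m ih =>
    simp only [rowWalkFrom, List.mem_cons, ih]
    constructor
    · rintro (rfl | ⟨i, hi, rfl⟩)
      · exact ⟨m + 1, le_rfl, rfl⟩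
      · exact ⟨i, by omega, rfl⟩
    · rintro ⟨i, hi, rfl⟩
      rcases Nat.lt_or_ge i (m + 1) with h | h
      · exact Or.inr ⟨i, by omega, rfl⟩
      · left; have : i = m + 1 := by omega
        subst this; rfl

/-- The straight walk is nonempty. [folklore] -/
theorem rowWalkFrom_ne_nil (k : ℤ) (m : ℕ) : rowWalkFrom k m ≠ [] := by
  cases m <;> simp [rowWalkFrom]

/-- Head of the straight walk. [folklore] -/
theorem head?_rowWalkFrom (k : ℤ) (m : ℕ) : (rowWalkFrom k m).head? = some (fj (k + m) 0) := by
  cases m with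
  | zero => simp [rowWalkFrom]
  | succ m => simp [rowWalkFrom]

/-- The straight walk decomposes as head and tail walk. [folklore] -/
theorem rowWalkFrom_succ (k : ℤ) (m : ℕ) :
    rowWalkFrom k (m + 1) = fj (k + (m + 1 : ℕ)) 0 :: rowWalkFrom k m := rfl

/-- Last element of the straight walk. [folklore] -/
theorem getLast?_rowWalkFrom (k : ℤ) (m : ℕ) : (rowWalkFrom k m).getLast? = some (fj k 0) := by
  induction m with
  | zero => rfl
  | succ m ih =>
    obtain ⟨b, l, hbl⟩ := List.exists_cons_of_ne_nil (rowWalkFrom_ne_nil k m)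
    rw [rowWalkFrom_succ, hbl, List.getLast?_cons_cons, ← hbl, ih]

/-- The straight walk has no repeated vertex. [folklore] -/
theorem nodup_rowWalkFrom (k : ℤ) (m : ℕ) : (rowWalkFrom k m).Nodup := by
  induction m with
  | zero => simp [rowWalkFrom]
  | succ m ih =>
    rw [rowWalkFrom_succ, List.nodup_cons]
    refine ⟨fun h => ?_, ih⟩
    obtain ⟨i, hi, he⟩ := mem_rowWalkFrom.1 h
    have := (fj_inj.1 he).1; push_cast at this; omega

/-- The straight walk is a chain of adjacent faces. [folklore] -/
theorem isChain_rowWalkFrom (k : ℤ) (m : ℕ) : (rowWalkFrom k m).IsChain hexGraph.Adj := by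
  induction m with
  | zero => exact List.isChain_singleton _
  | succ m ih =>
    obtain ⟨b, l, hbl⟩ := List.exists_cons_of_ne_nil (rowWalkFrom_ne_nil k m)
    have hb : b = fj (k + m) 0 := by
      have := head?_rowWalkFrom k m
      rw [hbl] at this
      simpa using this
    rw [rowWalkFrom_succ, hbl]
    rw [hbl] at ih
    refine List.IsChain.cons_cons ?_ ih
    rw [hb]
    have := (adj_fj_succ (k + m) 0).symm
    push_cast
    rwa [show k + (m : ℤ) + 1 = k + ((m : ℤ) + 1) by ring] at this

/-- **The straight walk as a self-avoiding walk** from the root edge at cell `N` to `bEdgeQ k`,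
`0 ≤ k ≤ N`, in any vertex set containing the faces `fj i 0`, `0 ≤ i ≤ 2N+1`. [folklore] -/
theorem nonempty_rowSAW_bEdgeQ (Λ : Finset HexVertex) (k N : ℕ) (hkN : k ≤ N)
    (hΛ : ∀ i : ℕ, i ≤ 2 * N + 1 → fj i 0 ∈ Λ) :
    Nonempty (HexMidEdgeSAW Λ (aEdge N) (bEdgeQ k)) := by
  -- the walk visits `fj (2k + i) 0`, `i = 2(N-k)+1, …, 0`
  set M : ℕ := 2 * (N - k) + 1 with hM
  have hkM : (2 * k : ℤ) + M = 2 * N + 1 := by rw [hM]; push_cast; omega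
  have hmem : ∀ e ∈ List.zipWith (fun u w => s(u, w)) (rowWalkFrom (2 * k) M) (rowWalkFrom (2 * k) M).tail,
      ∀ c ∈ e, ∃ i : ℕ, i ≤ M ∧ c = fj (2 * k + i) 0 := fun e he c hc =>
    mem_rowWalkFrom.1 (forall_mem_of_mem_edges _ e he c hc)
  have haL : aEdge (N : ℤ) ∉ List.zipWith (fun u w => s(u, w)) (rowWalkFrom (2 * k) M)
      (rowWalkFrom (2 * k) M).tail := by
    intro h
    obtain ⟨i, hi, he⟩ := hmem _ h (fj (2 * N + 2) 0) (by unfold aEdge; exact Sym2.mem_mk_left _ _)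
    have := (fj_inj.1 he).1; omega
  have hab : aEdge (N : ℤ) ≠ bEdgeQ k := by
    intro h
    have : fj (2 * (N : ℤ) + 2) 0 ∈ bEdgeQ k := by rw [← h]; unfold aEdge; exact Sym2.mem_mk_left _ _
    unfold bEdgeQ at this
    rcases Sym2.mem_iff.1 this with h1 | h1
    · have := (fj_inj.1 h1).1; omega
    · have := (fj_inj.1 h1).2; omega
  have hbL : bEdgeQ (k : ℤ) ∉ List.zipWith (fun u w => s(u, w)) (rowWalkFrom (2 * k) M)
      (rowWalkFrom (2 * k) M).tail := by
    intro he
    obtain ⟨i, hi, he'⟩ := hmem _ he (fj (2 * k + 1) (-1)) (by exact Sym2.mem_mk_right _ _)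
    have := (fj_inj.1 he').2; omega
  have hadj : hexGraph.Adj (fj (2 * (N : ℤ) + 2) 0) (fj (2 * N + 1) 0) := by
    have := (adj_fj_succ (2 * (N : ℤ) + 1) 0).symm
    rwa [show 2 * (N : ℤ) + 1 + 1 = 2 * N + 2 by ring] at this
  refine ⟨{ verts := rowWalkFrom (2 * k) M
            subset := fun v hv => ?_
            nodup := nodup_rowWalkFrom _ _
            isChain := isChain_rowWalkFrom _ _
            head_mem := fun v hv => ?_
            getLast_mem := fun v hv => ?_
            eq_of_nil := fun h => (rowWalkFrom_ne_nil _ _ h).elim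
            edges_nodup := fun _ => ?_
            fst_mem := ⟨(SimpleGraph.mem_edgeSet hexGraph).2 hadj, fj (2 * N + 1) 0,
              by unfold aEdge; exact Sym2.mem_mk_right _ _, by exact_mod_cast hΛ (2 * N + 1) le_rfl⟩ }⟩
  · obtain ⟨i, hi, rfl⟩ := mem_rowWalkFrom.1 hv
    have := hΛ (2 * k + i) (by omega)
    push_cast at this ⊢
    exact this
  · rw [head?_rowWalkFrom, Option.some_inj] at hv
    subst hv
    rw [hkM]
    unfold aEdge
    exact Sym2.mem_mk_right _ _
  · rw [getLast?_rowWalkFrom, Option.some_inj] at hv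
    subst hv
    unfold bEdgeQ
    exact Sym2.mem_mk_left _ _
  · have hL := edges_nodup (nodup_rowWalkFrom (2 * (k : ℤ)) M)
    refine List.nodup_append.2 ⟨List.nodup_cons.2 ⟨haL, hL⟩, List.nodup_singleton _, ?_⟩
    intro e he f hf
    rw [List.mem_singleton] at hf
    subst hf
    rcases List.mem_cons.1 he with rfl | he
    · exact hab
    · rintro rfl; exact hbL he

section Geometry

variable {δ : ℝ} (hδ : 0 < δ) (hδ' : δ ≤ 1 / 16) (wc : Bool)
include hδ hδ'

/-- **There is a self-avoiding walk from the root edge to the second normalisation edge.** [folklore] -/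
theorem nonempty_saw_bEdgeQ :
    Nonempty (HexMidEdgeSAW (Lam δ wc) (aEdge (rootCell δ wc)) (bEdgeQ (Nc δ))) := by
  have hb := rootCell_bounds hδ hδ' wc
  have hX := Xc_pos hδ (δ := δ)
  have hN := Nc_pos_lt_Xc hδ hδ'
  obtain ⟨N, hN'⟩ : ∃ N : ℕ, (N : ℤ) = rootCell δ wc := ⟨(rootCell δ wc).toNat, by omega⟩
  obtain ⟨k, hk⟩ : ∃ k : ℕ, (k : ℤ) = Nc δ := ⟨(Nc δ).toNat, by omega⟩
  rw [← hN', ← hk]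
  exact nonempty_rowSAW_bEdgeQ (Lam δ wc) k N (by omega)
    fun i hi => fj_row_zero_mem hδ hδ' wc (by omega) (by omega)

/-- The second normalisation edge avoids the corridor faces. [folklore] -/
theorem corridor_not_mem_bEdgeQ (i : ℤ) (hi : 2 * Xc δ + 2 ≤ i) : fj i 0 ∉ bEdgeQ (Nc δ) := by
  have hN := Nc_pos_lt_Xc hδ hδ'
  unfold bEdgeQ
  intro hmem
  rcases Sym2.mem_iff.1 hmem with h | h
  · have := (fj_inj.1 h).1; omega
  · have := (fj_inj.1 h).2; omega

omit hδ hδ' in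
/-- The first normalisation edge avoids the corridor faces. [folklore] -/
theorem corridor_not_mem_bEdge (hX : 0 < Xc δ) (i : ℤ) (hi : 2 * Xc δ + 2 ≤ i) : fj i 0 ∉ bEdge := by
  unfold bEdge
  intro hmem
  rcases Sym2.mem_iff.1 hmem with h | h
  · have := (fj_inj.1 h).1; omega
  · have := (fj_inj.1 h).2; omega

/-- **The two configurations have the same floor ratio**: for `0 < δ ≤ 1/16`,
`F^{body∪corridor}_{a_T}(b')/F^{body∪corridor}_{a_T}(b) = F^{body}_{a_X}(b')/F^{body}_{a_X}(b)`.
[folklore] -/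
theorem ratio_eq_corridor (x σ : ℝ) (hx : x ≠ 0) :
    hexParafermionicObservable (Lam δ true) (aEdge (Tc δ)) x σ (bEdgeQ (Nc δ)) /
        hexParafermionicObservable (Lam δ true) (aEdge (Tc δ)) x σ bEdge =
      hexParafermionicObservable (Lam δ false) (aEdge (Xc δ)) x σ (bEdgeQ (Nc δ)) /
        hexParafermionicObservable (Lam δ false) (aEdge (Xc δ)) x σ bEdge := by
  obtain ⟨κ, hκ, hrel⟩ := observable_corridor hδ hδ' x σ hx
  have hX := Xc_pos hδ (δ := δ)
  rw [hrel _ fun i hi => corridor_not_mem_bEdgeQ hδ hδ' i hi,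
    hrel _ fun i hi => corridor_not_mem_bEdge hX i hi, mul_div_mul_left _ _ hκ]

end Geometry

/-! ## §2 The re-marked half-disc `(HD; r, 1/4)` and flatness at radius `1/4` -/

/-- **The half-disc with marked points `r ∈ (1/4, 1)` and `1/4`.** [folklore] -/
def halfDiscDomainQ (r : ℝ) (hr : 1 / 4 < r ∧ r < 1) : DobrushinDomain where
  toJordanDomain := halfDiscJordan
  mark := ![(3 - r) / 4, 11 / 16]
  strictMono_mark := by
    refine Fin.strictMono_iff_lt_succ.2 fun k => ?_
    fin_cases k
    simp; linarith [hr.1]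
  mark_mem k := by
    fin_cases k
    · simp; constructor <;> linarith [hr.1, hr.2]
    · simp; norm_num

/-- The first marked point is `r`. [folklore] -/
theorem pt_zero_halfDiscDomainQ (r : ℝ) (hr : 1 / 4 < r ∧ r < 1) :
    (halfDiscDomainQ r hr).pt 0 = (r : ℂ) := by
  show bdry ((3 - r) / 4) = r
  rw [bdry_eq_of_mem ⟨by linarith [hr.2], by linarith [hr.1]⟩, bdryFun_of_gt (by linarith [hr.2])]
  push_cast; ring

/-- The second marked point is `1/4`. [folklore] -/
theorem pt_one_halfDiscDomainQ (r : ℝ) (hr : 1 / 4 < r ∧ r < 1) :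
    (halfDiscDomainQ r hr).pt 1 = ((1 / 4 : ℝ) : ℂ) := by
  show bdry (11 / 16) = ((1 / 4 : ℝ) : ℂ)
  rw [bdry_eq_of_mem ⟨by norm_num, by norm_num⟩, bdryFun_of_gt (by norm_num)]
  norm_num

/-- Flatness at `0`, radius `1/4`. [folklore] -/
theorem HD_inter_ball_quarter :
    HD ∩ ball (0 : ℂ) (1 / 4) = {z : ℂ | (0 : ℂ).im < z.im} ∩ ball (0 : ℂ) (1 / 4) := by
  ext z
  simp only [HD, mem_inter_iff, mem_setOf_eq, Metric.mem_ball, dist_zero_right, Complex.zero_im]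
  constructor
  · rintro ⟨⟨-, h⟩, h'⟩; exact ⟨h, h'⟩
  · rintro ⟨h, h'⟩; exact ⟨⟨by linarith, h⟩, h'⟩

/-- The ball of radius `1/4` about `1/4` lies in the ball of radius `1/2` about `0`. [folklore] -/
theorem ball_quarter_subset : ball ((1 / 4 : ℝ) : ℂ) (1 / 4) ⊆ ball (0 : ℂ) (1 / 2) := by
  intro z hz
  rw [Metric.mem_ball, dist_eq_norm] at hz
  rw [Metric.mem_ball, dist_zero_right]
  have hc : ‖((1 / 4 : ℝ) : ℂ)‖ = 1 / 4 := by
    rw [Complex.norm_real, Real.norm_of_nonneg (by norm_num)]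
  calc ‖z‖ = ‖(z - ((1 / 4 : ℝ) : ℂ)) + ((1 / 4 : ℝ) : ℂ)‖ := by rw [sub_add_cancel]
    _ ≤ ‖z - ((1 / 4 : ℝ) : ℂ)‖ + ‖((1 / 4 : ℝ) : ℂ)‖ := norm_add_le _ _
    _ < 1 / 4 + 1 / 4 := by rw [hc]; linarith
    _ = 1 / 2 := by norm_num

/-- **Flatness of the half-disc at a real point `c` with `|c| ≤ 3/4`, radius `1/4`.** [folklore] -/
theorem HD_inter_ball_real {c : ℝ} (hc : |c| ≤ 3 / 4) :
    HD ∩ ball ((c : ℝ) : ℂ) (1 / 4) = {z : ℂ | ((c : ℝ) : ℂ).im < z.im} ∩ ball ((c : ℝ) : ℂ) (1 / 4) := by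
  ext z
  simp only [HD, mem_inter_iff, mem_setOf_eq, Complex.ofReal_im]
  constructor
  · rintro ⟨⟨-, h⟩, h'⟩; exact ⟨h, h'⟩
  · rintro ⟨h, h'⟩
    refine ⟨⟨?_, h⟩, h'⟩
    have hz : ‖z - (c : ℂ)‖ < 1 / 4 := by rw [← dist_eq_norm]; exact h'
    have hcn : ‖(c : ℂ)‖ = |c| := by rw [Complex.norm_real, Real.norm_eq_abs]
    calc ‖z‖ = ‖(z - (c : ℂ)) + (c : ℂ)‖ := by rw [sub_add_cancel]
      _ ≤ ‖z - (c : ℂ)‖ + ‖(c : ℂ)‖ := norm_add_le _ _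
      _ < 1 / 4 + 3 / 4 := by rw [hcn]; linarith
      _ = 1 := by norm_num

/-! ## §3 The logarithm `L_r` at real points of the floor -/

/-- The real logarithm of `Φ_r'` on the floor segment `(-1, r)`. [folklore] -/
def lreal (r x : ℝ) : ℝ :=
  Real.log ((1 - r) ^ 2 * r) + Real.log (1 - x ^ 2) - 2 * Real.log (r - x) - 2 * Real.log (1 - r * x)

/-- On the floor segment `(-1, r)` the complex logarithm `L_r` is the real one. [folklore] -/
theorem Lfun_ofReal {r x : ℝ} (hr : 0 < r ∧ r < 1) (hx : -1 < x ∧ x < r) :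
    Lfun r (x : ℂ) = (lreal r x : ℂ) := by
  have h1 : 0 ≤ (1 - r) ^ 2 * r := mul_nonneg (sq_nonneg _) hr.1.le
  have h2 : 0 ≤ 1 - x ^ 2 := by nlinarith [hx.1, hx.2, hr.2]
  have h3 : 0 ≤ r - x := by linarith [hx.2]
  have h4 : 0 ≤ 1 - r * x := by nlinarith [hx.1, hx.2, hr.1, hr.2]
  unfold Lfun lreal
  rw [show (1 : ℂ) - (x : ℂ) ^ 2 = ((1 - x ^ 2 : ℝ) : ℂ) by push_cast; ring,
    show (r : ℂ) - (x : ℂ) = ((r - x : ℝ) : ℂ) by push_cast; ring,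
    show (1 : ℂ) - (r : ℂ) * (x : ℂ) = ((1 - r * x : ℝ) : ℂ) by push_cast; ring,
    ← Complex.ofReal_log h1, ← Complex.ofReal_log h2, ← Complex.ofReal_log h3,
    ← Complex.ofReal_log h4]
  push_cast; ring

/-- `L_r 0` is real. [folklore] -/
theorem Lfun_zero_ofReal {r : ℝ} (hr : 0 < r ∧ r < 1) : Lfun r 0 = (lreal r 0 : ℂ) := by
  rw [← Complex.ofReal_zero, Lfun_ofReal hr ⟨by norm_num, hr.1⟩]

/-- The three arguments of `L_r` avoid the negative real axis at a floor point `x ∈ (-1, r)`.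
[folklore] -/
theorem slit_ofReal {r x : ℝ} (hr : 0 < r ∧ r < 1) (hx : -1 < x ∧ x < r) :
    1 - (x : ℂ) ^ 2 ∈ Complex.slitPlane ∧ (r : ℂ) - x ∈ Complex.slitPlane ∧
      1 - (r : ℂ) * x ∈ Complex.slitPlane := by
  refine ⟨?_, ?_, ?_⟩
  · rw [show (1 : ℂ) - (x : ℂ) ^ 2 = ((1 - x ^ 2 : ℝ) : ℂ) by push_cast; ring,
      Complex.ofReal_mem_slitPlane]
    nlinarith [hx.1, hx.2, hr.2]
  · rw [show (r : ℂ) - (x : ℂ) = ((r - x : ℝ) : ℂ) by push_cast; ring, Complex.ofReal_mem_slitPlane]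
    linarith [hx.2]
  · rw [show (1 : ℂ) - (r : ℂ) * (x : ℂ) = ((1 - r * x : ℝ) : ℂ) by push_cast; ring,
      Complex.ofReal_mem_slitPlane]
    nlinarith [hx.1, hx.2, hr.1, hr.2]

/-- **`L_r` has the boundary value `L_r x` at a floor point `x ∈ (-1, r)`.** [folklore] -/
theorem tendsto_Lfun_ofReal {r x : ℝ} (hr : 0 < r ∧ r < 1) (hx : -1 < x ∧ x < r) :
    Tendsto (Lfun r) (𝓝[HD] (x : ℂ)) (𝓝 (Lfun r x)) :=
  (continuousAt_Lfun (slit_ofReal hr hx).1 (slit_ofReal hr hx).2.1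
    (slit_ofReal hr hx).2.2).tendsto.mono_left nhdsWithin_le_nhds

/-! ## §4 One instance of `FloorRatioLimit` on the half-disc -/

/-- **One instance of `FloorRatioLimitRootFlat`**: configuration `wc` (root cell `X ↦ 1/2` for the
body, `T ↦ 3/4` for body ∪ corridor), normalisation edges `bEdge → 0` and `bEdgeQ (Nc δ) → 1/4`,
radius `1/4` (so the root `r ≤ 3/4` is a flat point too), gives the ratio limit
`exp((5/8)(L_r(1/4) - L_r(0)))`. [folklore] -/
theorem ratio_limit_instance (H : FloorRatioLimitRootFlat) {r : ℝ} (hr : 1 / 4 < r ∧ r ≤ 3 / 4)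
    (wc : Bool) (hroot : ∀ δ : ℝ, 0 < δ → |δ * rootCell δ wc - r| ≤ δ) :
    Tendsto (fun δ : ℝ =>
        hexParafermionicObservable (Lam δ wc) (aEdge (rootCell δ wc)) hexCriticalFugacity (5 / 8)
            (bEdgeQ (Nc δ)) /
          hexParafermionicObservable (Lam δ wc) (aEdge (rootCell δ wc)) hexCriticalFugacity (5 / 8)
            bEdge)
      (𝓝[>] 0)
      (𝓝 (Complex.exp ((5 / 8 : ℂ) *
        ((lreal r (1 / 4) : ℂ) - (lreal r 0 : ℂ))))) := by
  have hr0 : 0 < r ∧ r < 1 := ⟨by linarith [hr.1], by linarith [hr.2]⟩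
  have hr1 : 1 / 4 < r ∧ r < 1 := ⟨hr.1, hr0.2⟩
  have hx : -1 < (1 / 4 : ℝ) ∧ (1 / 4 : ℝ) < r := ⟨by norm_num, hr.1⟩
  have H' := H (halfDiscDomain r hr0) (halfDiscDomainQ r hr1) (1 / 4) (fun δ => Lam δ wc)
    (fun _ => 0) (fun _ => 0) (fun δ => aEdge (rootCell δ wc)) (fun _ => bEdge)
    (fun δ => bEdgeQ (Nc δ)) (PhiCE r hr0) (Lfun r) (Lfun r 0) (Lfun r ((1 / 4 : ℝ) : ℂ))
  simp only [pt_zero_halfDiscDomain, pt_one_halfDiscDomain, pt_zero_halfDiscDomainQ,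
    pt_one_halfDiscDomainQ] at H'
  rw [Lfun_ofReal hr0 hx, Lfun_zero_ofReal hr0] at H'
  have hflat0 := HD_inter_ball_real (c := r) (by rw [abs_of_pos hr0.1]; exact hr.2)
  have hflatQ := HD_inter_ball_real (c := 1 / 4) (by rw [abs_of_pos (by norm_num)]; norm_num)
  refine H' rfl trivial (by norm_num) hflat0 HD_inter_ball_quarter hflatQ ?_ ?_ ?_ ?_ ?_
    (tendsto_norm_PhiCE hr0) (tendsto_PhiCE_zero hr0) (continuousOn_Lfun hr0)
    (fun z hz => exp_Lfun hr0 hz) ?_ ?_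
  · -- the discrete hypotheses, for `0 < δ ≤ 1/16`
    filter_upwards [eventually_small one_pos] with δ hδ
    obtain ⟨hδ, hδ', -⟩ := hδ
    refine ⟨simplyConnected_Lam hδ hδ' wc, aEdge_mem_boundary hδ hδ' wc, bEdge_mem_boundary hδ hδ' wc,
      bEdgeQ_mem_boundary hδ hδ' wc, nonempty_saw hδ hδ' wc, nonempty_saw_bEdgeQ hδ hδ' wc,
      preconnected_Lam hδ hδ' wc, fun v hv => smul_center_mem_HD hδ hδ' wc hv, fun v hv => ?_,
      fun v hv => ?_⟩
    · exact mem_Lam_iff_of_ball hδ hδ' wc (Metric.ball_subset_ball (by norm_num) hv)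
    · exact mem_Lam_iff_of_ball hδ hδ' wc (ball_quarter_subset hv)
  · -- exhaustion of compacts
    intro K hK hKD
    obtain ⟨ε, hε, hε1, hthick⟩ := exists_thick_of_isCompact hK hKD
    filter_upwards [eventually_small (by positivity : 0 < ε / 4)] with δ hδ v hv
    obtain ⟨hδ, hδ', hδε⟩ := hδ
    obtain ⟨hn, hi⟩ := hthick _ hv
    exact mem_Lam_of_thick hδ hδ' wc hδε hn hi
  · exact tendsto_smul_midpoint_aEdge hroot
  · exact tendsto_smul_midpoint_bEdge
  · exact tendsto_smul_midpoint_bEdgeQ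
  · rw [← Lfun_zero_ofReal hr0]; exact tendsto_Lfun_zero hr0
  · rw [← Lfun_ofReal hr0 hx]; exact tendsto_Lfun_ofReal hr0 hx

/-! ## §5 The endgame at a floor point -/

/-- **Incompatibility of the two predicted ratio limits**: for `p ≠ q` in `(0,1)` and a floor
point `0 < x < min p q`, `exp((5/8)(l_q x - l_q 0)) ≠ exp((5/8)(l_p x - l_p 0))`
(it would force `x (p - q)(1 - p q) = 0`). [folklore] -/
theorem endgame_real {p q x : ℝ} (hp : 0 < p ∧ p < 1) (hq : 0 < q ∧ q < 1) (hpq : p ≠ q)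
    (hx0 : 0 < x) (hxp : x < p) (hxq : x < q)
    (h : Complex.exp ((5 / 8 : ℂ) * ((lreal q x : ℂ) - (lreal q 0 : ℂ))) =
      Complex.exp ((5 / 8 : ℂ) * ((lreal p x : ℂ) - (lreal p 0 : ℂ)))) : False := by
  -- both exponents are real, hence equal
  rw [show (5 / 8 : ℂ) * ((lreal q x : ℂ) - (lreal q 0 : ℂ)) = (((5 / 8) * (lreal q x - lreal q 0) : ℝ) : ℂ) by
      push_cast; ring,
    show (5 / 8 : ℂ) * ((lreal p x : ℂ) - (lreal p 0 : ℂ)) = (((5 / 8) * (lreal p x - lreal p 0) : ℝ) : ℂ) by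
      push_cast; ring, Complex.exp_eq_exp_iff_exists_int] at h
  obtain ⟨n, hn⟩ := h
  have hn0 : n = 0 := by
    have him := congrArg Complex.im hn
    simp only [Complex.ofReal_im, Complex.add_im, Complex.mul_im, Complex.intCast_re,
      Complex.intCast_im, Complex.mul_re, Complex.re_ofNat, Complex.ofReal_re, Complex.im_ofNat,
      Complex.ofReal_im, Complex.I_re, Complex.I_im, mul_zero, sub_zero, zero_mul, add_zero,
      mul_one, zero_add] at him
    have : (n : ℝ) * (2 * Real.pi) = 0 := by linarith
    rcases mul_eq_zero.1 this with h | h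
    · exact_mod_cast h
    · exfalso; linarith [Real.pi_pos]
  rw [hn0] at hn
  simp only [Int.cast_zero, zero_mul, add_zero, Complex.ofReal_inj] at hn
  have hab : lreal q x - lreal q 0 = lreal p x - lreal p 0 := by linarith
  -- unfold the real logarithms: `log(p-x) + log(1-px) - log p = log(q-x) + log(1-qx) - log q`
  have key : Real.log (p - x) + Real.log (1 - p * x) - Real.log p =
      Real.log (q - x) + Real.log (1 - q * x) - Real.log q := by
    unfold lreal at hab
    simp only [mul_zero, sub_zero, ne_eq, OfNat.ofNat_ne_zero, not_false_eq_true, zero_pow,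
      Real.log_one, add_zero] at hab
    linarith
  have e : ∀ r : ℝ, 0 < r → 0 < r - x → 0 < 1 - r * x →
      Real.exp (Real.log (r - x) + Real.log (1 - r * x) - Real.log r) = (r - x) * (1 - r * x) / r := by
    intro r h0 h3 h4
    rw [Real.exp_sub, Real.exp_add, Real.exp_log h3, Real.exp_log h4, Real.exp_log h0]
  have hp4 : 0 < 1 - p * x := by nlinarith
  have hq4 : 0 < 1 - q * x := by nlinarith
  have key2 : (p - x) * (1 - p * x) / p = (q - x) * (1 - q * x) / q := by
    rw [← e p hp.1 (by linarith) hp4, ← e q hq.1 (by linarith) hq4, key]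
  rw [div_eq_div_iff hp.1.ne' hq.1.ne'] at key2
  have hz : x * ((p - q) * (1 - p * q)) = 0 := by linear_combination key2
  rcases mul_eq_zero.1 hz with h1 | h1
  · exact hx0.ne' h1
  · rcases mul_eq_zero.1 h1 with h2 | h2
    · exact hpq (by linarith)
    · nlinarith [hp.1, hp.2, hq.1, hq.2]

/-! ## §6 The refutations -/

/-- **`FloorRatioLimitRootFlat` is FALSE**: even with the Jordan domain flat at the root, the floor
ratio limit fails without the exact-row clause at `pt 0` (corridor witness: on the half-disc the
body / body ∪ corridor discretisations, with roots at the junction edge `→ 1/2` and at the corridor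
tip `→ 3/4`, have IDENTICAL ratios `F_δ(b'_δ)/F_δ(b_δ)` for `δ ≤ 1/16`, while the predicted limits
`exp((5/8)(L_r(1/4) - L_r(0)))`, `r = 1/2, 3/4`, differ).  So in the reshaped stub 1
(`HexObservableLimit → FloorRatioLimit`, root pinned by flatness AND exact half-lattice rows in
`ball (D.pt 0) ρ`) the rows clause is load-bearing; the witness misses the reshaped statement. [folklore] -/
theorem not_floorRatioLimitRootFlat : ¬ FloorRatioLimitRootFlat := by
  intro H
  have hp : (1 / 4 : ℝ) < 3 / 4 ∧ (3 / 4 : ℝ) ≤ 3 / 4 := by norm_num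
  have hq : (1 / 4 : ℝ) < 1 / 2 ∧ (1 / 2 : ℝ) ≤ 3 / 4 := by norm_num
  have hx : hexCriticalFugacity ≠ 0 := hexCriticalFugacity_pos_lt_one.1.ne'
  have h1 := ratio_limit_instance H hq false (fun δ hδ => abs_Xc δ hδ)
  have h2 := ratio_limit_instance H hp true (fun δ hδ => abs_Tc δ hδ)
  simp only [rootCell, Bool.false_eq_true, ↓reduceIte] at h1
  simp only [rootCell, ↓reduceIte] at h2
  -- the two ratio sequences agree for small `δ`
  have heq : (fun δ : ℝ =>
      hexParafermionicObservable (Lam δ true) (aEdge (Tc δ)) hexCriticalFugacity (5 / 8) (bEdgeQ (Nc δ)) /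
        hexParafermionicObservable (Lam δ true) (aEdge (Tc δ)) hexCriticalFugacity (5 / 8) bEdge)
      =ᶠ[𝓝[>] 0]
      fun δ : ℝ =>
      hexParafermionicObservable (Lam δ false) (aEdge (Xc δ)) hexCriticalFugacity (5 / 8) (bEdgeQ (Nc δ)) /
        hexParafermionicObservable (Lam δ false) (aEdge (Xc δ)) hexCriticalFugacity (5 / 8) bEdge := by
    filter_upwards [eventually_small one_pos] with δ hδ
    exact ratio_eq_corridor hδ.1 hδ.2.1 _ _ hx
  have hlim := tendsto_nhds_unique h1 (h2.congr' heq)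
  exact endgame_real (p := 3 / 4) (q := 1 / 2) (x := 1 / 4) (by norm_num) (by norm_num) (by norm_num)
    (by norm_num) (by norm_num) (by norm_num) hlim

/-- **`FloorRatioLimitUnpinned` (the crux-plan typing of `FloorRatioLimit`, commit eead1a5a399f) is
FALSE** — a fortiori.  With it the then-registered `stub_targetTransport` was `¬ HexObservableLimit`
in disguise and `stub_restrictionCocycle : FloorRatioLimit → …` vacuous; the lead's reshape
(2026-08-16T00:38Z) added the two root clauses, and `not_floorRatioLimitRootFlat` shows which of the
two is the load-bearing one. [folklore] -/
theorem not_floorRatioLimitUnpinned : ¬ FloorRatioLimitUnpinned :=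
  fun H => not_floorRatioLimitRootFlat (floorRatioLimitRootFlat_of_unpinned H)

/-- The crux-plan stub 1 as typed (`HexObservableLimit → FloorRatioLimitUnpinned`) was equivalent to
the negation of the route's rev-4 target — the reason for the reshape. [folklore] -/
theorem unpinnedTargetTransport_iff_not_hexObservableLimit :
    (Summit.CriticalPhenomena.SAWScalingLimit.Theses.SAWDevelopingMap.HexObservableLimit →
        FloorRatioLimitUnpinned) ↔
      ¬ Summit.CriticalPhenomena.SAWScalingLimit.Theses.SAWDevelopingMap.HexObservableLimit :=
  ⟨fun h hO => not_floorRatioLimitUnpinned (h hO), fun h hO => absurd hO h⟩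

end Summit.CriticalPhenomena.SAWScalingLimit.Theorems.ObservableToSLE.Negative

end
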